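import Mathlib
import Summits.BirchSwinnertonDyer.Rank1Residual.ManinAdditive.TwoEisensteinRankOneLaws
import Summits.BirchSwinnertonDyer.Rank1Residual.ManinAdditive.OddDegreeTooth
import Summits.BirchSwinnertonDyer.BirchSwinnertonDyer.Theorems.ManinLocalTwoThreeRankOneForcesOddCongruence
import Literature.NumberTheory.EllipticCurves.ManinConstantModularDegree
import Literature.NumberTheory.EllipticCurves.ManinConstantSemistablePrimewise
import Literature.NumberTheory.EllipticCurves.CuspFormLFunctionLevelConductorProofs
import Literature.NumberTheory.EllipticCurves.ModularCurveManinSemistableKernelProofs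
import HarnessLib

/-!
# The blind tame family `E′_m` under 2-Eisenstein rank one: E-imc-85 ⟹ (ARS) E-an-74 odd degree ⟹ (ČNS) `2 ∤ c₀`
# ⟹ (Mazur) `|c₀| = 1` — BY NAME

Summit `BirchSwinnertonDyer`, route `ManinLocalTwoThree` (cell bsd-f2-manin), deciding crux C2 `ManinOddAtFour`
(stmt-BirchSwinnertonDyer-22967, skeleton v11 `kato_shift_two`, stub 6d `stub_blindTameOptimalOddDegree` = an's E-an-73; its
explicit-family form is E-an-74 `OddDegreeTooth.FourPBlindFamilyOddDegree`).  The planner-of-record's chain for stub 6d on the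
FAMILY `E′_m : y² = x³ − 2m x² + (m² + 4) x` (`m ≡ 1 (mod 4)`, `p = m² + 4` prime; imc g16, MEMO-imc §22.11 (2)):
«rank one at `4p` ⟹ `2 ∤ r_f` ⟹ (ARS) `2 ∤ deg φ₀` ⟹ (ČNS) `2 ∤ c₀` ⟹ (Mazur at `p ∥ N`) `|c₀| = 1`».  With E-imc-87 now a
THEOREM (`rankOneForcesOddCongruence_holds`, sibling file), every arrow after the first is kernel-checked here BY NAME:

* `odd_congruenceNumber_blindCurve_of_rankOne` — E-85 ⟹ `r_f` odd for every datum of an's `blindCurve m` at level `4p`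
  (transport along `blindCurve m = ⟨0, −2m, 0, p, 0⟩`);
* `fourPBlindFamilyOddDegree_of_rankOne` — **E-85 ∧ ARS Thm 2.1 (`modularDegree_dvd_congruenceNumber`, printed, by name)
  ⟹ E-an-74 `FourPBlindFamilyOddDegree`** (lattice-optimal ⟹ degree-minimal by the tree's
  `forall_modularDegree_le_of_latticeEq`);
* `fourPBlindFamilyManinOdd_of_rankOne` — **∧ ČNS Thm 1.2 ∧ modularity (`exists_isNewformOf`) ⟹ `FourPBlindFamilyManinOdd`**
  (C2 on the explicit blind tame family; `ε₂(4p) = 0` since `8 ∤ 4p`);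
* `fourPBlindFamilyManinOne_of_rankOne` — **∧ Mazur 1978 (`mazur_not_dvd_maninConstant_of_odd`) ⟹ `FourPBlindFamilyManinOne`**
  (Manin's conjecture `|c₀| = 1` on the family: `4p` has no odd square factor).

So on the blind tame family the ONLY non-printed input left is the `c`-free, `E`-free census law E-imc-85
`FourPTwoEisensteinRankOne` (59/59 levels, MEMO-imc §21.9; ⟸ E-imc-81 at `2p` by imc g16's E-imc-94).  Nothing about BSD is
proved here; Manin's conjecture is not proved; C2 remains open (E-85, and the classification «blind tame optimal = family»
behind E-an-73, are laws).
-/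

-- `Summit.BirchSwinnertonDyer.BirchSwinnertonDyer` is the mandated summit-side namespace (single-conjunct summit).
set_option linter.dupNamespace false

noncomputable section

open scoped MatrixGroups ModularForm
open CongruenceSubgroup
open Literature.NumberTheory.EllipticCurves Literature.NumberTheory.EllipticCurves.ModularForms
open Summit.BirchSwinnertonDyer.Rank1Residual.ManinAdditive.TwoEisenstein
open Summit.BirchSwinnertonDyer.Rank1Residual.ManinAdditive.ShimuraLedger
open Summit.BirchSwinnertonDyer.Rank1Residual.ManinAdditive.OddDegreeTooth

namespace Summit.BirchSwinnertonDyer.BirchSwinnertonDyer.Theorems.ManinLocalTwoThree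

/-- an's `blindCurve m = ⟨0, −2m, 0, m² + 4, 0⟩` IS imc's family curve `⟨0, −2m, 0, p, 0⟩` when `p = m² + 4`. [folklore] -/
theorem blindCurve_eq_family {m : ℤ} {p : ℕ} (hp : (p : ℤ) = m ^ 2 + 4) :
    blindCurve m = (⟨0, -2 * (m : ℚ), 0, (p : ℚ), 0⟩ : WeierstrassCurve ℚ) := by
  have hpq : (p : ℚ) = (m : ℚ) ^ 2 + 4 := by exact_mod_cast hp
  rw [blindCurve, hpq]

/-- **E-imc-85 ⟹ odd congruence number on the blind tame family** (E-82 through the THEOREM E-imc-87, transported to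
an's `blindCurve m`): for `m ≡ 1 (mod 4)`, `p = m² + 4` prime and ANY `X₀(4p)`-datum `D` of `E′_m`, `r_{D.f}` is odd. -/
theorem odd_congruenceNumber_blindCurve_of_rankOne (h85 : FourPTwoEisensteinRankOne) (m : ℤ) (p : ℕ)
    [NeZero (4 * p)] (D : ModularParametrizationData (blindCurve m) (4 * p)) (hm : m % 4 = 1)
    (hp : (p : ℤ) = m ^ 2 + 4) (hpp : p.Prime) : Odd (congruenceNumber D.f) := by
  have h82 : FourPFamilyCongruenceOdd := rankOneForcesOddCongruence_holds h85
  have key : ∀ W : WeierstrassCurve ℚ, W = (⟨0, -2 * (m : ℚ), 0, (p : ℚ), 0⟩ : WeierstrassCurve ℚ) →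
      ∀ D' : ModularParametrizationData W (4 * p), Odd (congruenceNumber D'.f) := by
    intro W hW D'
    subst hW
    exact h82 m p D' hm hp hpp
  exact key (blindCurve m) (blindCurve_eq_family hp) D

/-- **E-imc-85 ∧ ARS ⟹ E-an-74 `FourPBlindFamilyOddDegree`** — rank one at `4p` and Ribet's printed `deg φ ∣ r_f`
(Agashe–Ribet–Stein 2012 Thm 2.1, tree fact `modularDegree_dvd_congruenceNumber`, BY NAME as a hypothesis) give ODD optimal
degree on the explicit blind tame family (the lattice clause makes the datum degree-minimal,
`forall_modularDegree_le_of_latticeEq`). [cite: AgasheRibetStein2012, Thm. 2.1] -/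
theorem fourPBlindFamilyOddDegree_of_rankOne (h85 : FourPTwoEisensteinRankOne)
    (hARS : modularDegree_dvd_congruenceNumber) : FourPBlindFamilyOddDegree := by
  intro m p _ _ _ D hm hp hpp hopt
  change Odd D.modularDegree
  exact (odd_congruenceNumber_blindCurve_of_rankOne h85 m p D hm hp hpp).of_dvd_nat
    (hARS (blindCurve m) (4 * p) D (D.forall_modularDegree_le_of_latticeEq hopt))

/-- **E-imc-85 ∧ ARS ∧ ČNS ∧ modularity ⟹ `FourPBlindFamilyManinOdd`** — C2 (`2 ∤ c₀`) on the explicit blind tame family: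
odd optimal degree (previous theorem) and Česnavičius–Neururer–Saha Thm 1.2 at `2` with `ε₂(4p) = 0` (`8 ∤ 4p`), the level
being the conductor by modularity (`exists_isNewformOf`).  All three printed inputs BY NAME as hypotheses.
[cite: CesnaviciusNeururerSaha2023, Thm. 1.2] [cite: AgasheRibetStein2012, Thm. 2.1] -/
theorem fourPBlindFamilyManinOdd_of_rankOne (h85 : FourPTwoEisensteinRankOne)
    (hARS : modularDegree_dvd_congruenceNumber) (hcns : cesnaviciusNeururerSaha_thm_1_2)
    (hnf : exists_isNewformOf) : FourPBlindFamilyManinOdd := by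
  intro m p _ _ _ D hm hp hpp hopt
  have hodd : Odd D.modularDegree := fourPBlindFamilyOddDegree_of_rankOne h85 hARS m p D hm hp hpp hopt
  have h8 : ¬ 2 ^ 3 ∣ 4 * p := not_eight_dvd_level hm hp
  -- the level is the conductor (modularity), so ČNS Thm 1.2 at `2` reads `v₂(c₀) ≤ v₂(deg φ₀)`
  have key : ∀ (N : ℕ) [NeZero N] (D' : ModularParametrizationData (blindCurve m) N),
      N = (blindCurve m).conductorNorm ℤ → ¬ 2 ^ 3 ∣ N → Odd D'.modularDegree → ¬ (2 : ℤ) ∣ D'.maninConstant := by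
    intro N _ D' hN hN8 hodd'
    subst hN
    exact not_dvd_maninConstant_of_padicVal_le_of_not_dvd D' Nat.prime_two
      (padicValInt_two_maninConstant_le_modularDegree hcns (blindCurve m) D' (Or.inl hN8))
      (fun h2 ↦ (Nat.not_even_iff_odd.mpr hodd') (even_iff_two_dvd.mpr h2))
  exact key (4 * p) D (IsNewformOf.level_eq_conductorNorm_of_exists_isNewformOf hnf D.isNewformOf) h8 hodd

/-- **E-imc-85 ∧ ARS ∧ ČNS ∧ Mazur ∧ modularity ⟹ `FourPBlindFamilyManinOne`** — Manin's conjecture `|c₀| = 1` on the explicit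
blind tame family: `2 ∤ c₀` (previous theorem) and, at every odd prime `q`, `q² ∤ 4p` (since `p` is an odd prime), so Mazur 1978
(`mazur_not_dvd_maninConstant_of_odd`, BY NAME) gives `q ∤ c₀`.  The only non-printed input is the census law E-imc-85.
[cite: Mazur1978, Cor. 4.1] [cite: CesnaviciusNeururerSaha2023, Thm. 1.2] [cite: AgasheRibetStein2012, Thm. 2.1] -/
theorem fourPBlindFamilyManinOne_of_rankOne (h85 : FourPTwoEisensteinRankOne)
    (hARS : modularDegree_dvd_congruenceNumber) (hcns : cesnaviciusNeururerSaha_thm_1_2)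
    (hmz : mazur_not_dvd_maninConstant_of_odd) (hnf : exists_isNewformOf) : FourPBlindFamilyManinOne := by
  intro m p _ _ _ D hm hp hpp hopt
  have h2 : ¬ (2 : ℤ) ∣ D.maninConstant := fourPBlindFamilyManinOdd_of_rankOne h85 hARS hcns hnf m p D hm hp hpp hopt
  refine Nat.eq_one_iff_not_exists_prime_dvd.mpr fun q hq hqc ↦ ?_
  have hqc' : (q : ℤ) ∣ D.maninConstant := Int.natCast_dvd.mpr hqc
  by_cases hq2 : q = 2
  · subst hq2
    exact h2 (by exact_mod_cast hqc')
  · refine hmz (blindCurve m) D hopt q hq hq2 ?_ hqc'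
    exact not_sq_dvd_level hm hp hpp q hq hq2

end Summit.BirchSwinnertonDyer.BirchSwinnertonDyer.Theorems.ManinLocalTwoThree

end
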